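import Mathlib

/-!
# Subfield cell — the fibre summation: (F1) + (F2) + (F2N) ⟹ the triple-product bound (KL-P)

Unit `b2b-lgcu-subfield` (gen 20), supporting `stmt-MatrixMultiplication-7610` (SUBFIELD.md §25,
`BGTFreePlan.tripleProductBound_of_counting`).  Pure double counting, no field theory:
for `P ⊆ SL₂(k)`, `S₀ = ι(SL₂ k) ≤ SL₂(K)`, `N = N(S₀)` and `b, b' ∉ N`, count the triples
`(p₁, p₂, p₃) ∈ P³` by their product `w = ι(p₁) b ι(p₂) b' ι(p₃)`:
* the triples with `w ∈ N` are exactly those with `b ι(p₂) b' ∈ N` — at most `|P|·n₃·|P|` by (F2N);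
* a value `w ∉ N` has at most `n₁ · n₂` preimages: `p₂` ranges over the (F2)-set of `w`, and for
  fixed `p₂` the `p₁` form a translate of a subset of the (F1)-set `{h | w⁻¹ ι(h) w ∈ S₀}`
  (`p₃` is then determined).
Hence `|P|³ ≤ |P| n₃ |P| + n₁ n₂ |ι(P) b ι(P) b' ι(P)|` (`tripleProduct_fibre_count`), and with
`n₁ = 2q`, `n₂ = 4q(q+1)`, `n₃ = 8q(q+1)`:  `|P| (|P| − 16 q²) |P| ≤ 16 q³ |ι(P) b ι(P) b' ι(P)|`
(`tripleProductBound_of_counting`, the (KL-P) hypothesis of `structureSliced_of_tripleProduct`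
with `C₁ = C₂ = 16`, `q₀ = 1`).

HONEST FRAMING: bookkeeping toward an unconditional `¬ stub_subfieldCell`; (F2) and (F2N) are still
hypotheses here; NOT summit progress.  Sorry-free. [folklore]
-/

set_option linter.dupNamespace false

open scoped Pointwise MatrixGroups

namespace Summit.MatrixMultiplication.MatrixMultiplication.Theorems.GradedDesignFamily.Negative

/-- A finset all of whose elements satisfy `p` has at most `Nat.card {h // p h}` elements. [folklore] -/
theorem card_le_natCard_subtype {H : Type} [Fintype H] (p : H → Prop) (S : Finset H)
    (hS : ∀ h ∈ S, p h) : S.card ≤ Nat.card {h // p h} := by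
  classical
  rw [Nat.card_eq_fintype_card, Fintype.card_subtype]
  exact Finset.card_le_card fun h hh => by simp [hS h hh]

/-- **The fibre count** (abstract form).  `f : H →* G` injective, `N ≥ f(H)` a subgroup, `b b' : G`;
`n₁` bounds the (F1)-sets `{h | w⁻¹ f(h) w ∈ f(H)}` (`w ∉ N`), `n₂` the (F2)-sets
`{h | b f(h) b' ∈ f(H) w f(H)}` (`w ∉ N`), `n₃` the (F2N)-set `{h | b f(h) b' ∈ N}`.  Then
`|P|³ ≤ |P|·n₃·|P| + n₁ n₂ · |f(P) b f(P) b' f(P)|`. [folklore] -/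
theorem tripleProduct_fibre_count {H G : Type} [Group H] [Group G] [DecidableEq H] [DecidableEq G]
    (f : H →* G) (hf : Function.Injective f) (N : Subgroup G) (hSN : f.range ≤ N) (b b' : G)
    (P : Finset H) (n₁ n₂ n₃ : ℕ)
    (h1 : ∀ w : G, w ∉ N → ∀ S : Finset H, (∀ h ∈ S, w⁻¹ * f h * w ∈ f.range) → S.card ≤ n₁)
    (h2 : ∀ w : G, w ∉ N → ∀ S : Finset H,
      (∀ h ∈ S, ∃ s ∈ f.range, ∃ s' ∈ f.range, b * f h * b' = s * w * s') → S.card ≤ n₂)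
    (h3 : ∀ S : Finset H, (∀ h ∈ S, b * f h * b' ∈ N) → S.card ≤ n₃) :
    P.card * P.card * P.card ≤
      P.card * n₃ * P.card + n₁ * n₂ * (P.image f * {b} * P.image f * {b'} * P.image f).card := by
  classical
  set T : Finset ((H × H) × H) := (P ×ˢ P) ×ˢ P with hT
  set μ : (H × H) × H → G := fun t => f t.1.1 * b * f t.1.2 * b' * f t.2 with hμ
  set W : Finset G := P.image f * {b} * P.image f * {b'} * P.image f with hW
  have hTcard : T.card = P.card * P.card * P.card := by
    simp [hT, Finset.card_product]
  -- the bad triples: `μ t ∈ N`, i.e. `b f(p₂) b' ∈ N`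
  set Tbad := T.filter fun t => μ t ∈ N with hTbad
  set Tgood := T.filter fun t => μ t ∉ N with hTgood
  have hsplit : Tbad.card + Tgood.card = T.card := Finset.card_filter_add_card_filter_not _
  have hfN : ∀ h : H, f h ∈ N := fun h => hSN ⟨h, rfl⟩
  have hbad : Tbad.card ≤ P.card * n₃ * P.card := by
    set B := P.filter fun h => b * f h * b' ∈ N with hB
    have hsub : Tbad ⊆ (P ×ˢ B) ×ˢ P := by
      intro t ht
      simp only [hTbad, hT, Finset.mem_filter, Finset.mem_product] at ht
      obtain ⟨⟨⟨h11, h12⟩, h2⟩, hN⟩ := ht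
      simp only [hB, Finset.mem_product, Finset.mem_filter]
      refine ⟨⟨h11, h12, ?_⟩, h2⟩
      have e : b * f t.1.2 * b' = (f t.1.1)⁻¹ * μ t * (f t.2)⁻¹ := by
        simp only [hμ]; group
      rw [e]
      exact N.mul_mem (N.mul_mem (N.inv_mem (hfN _)) hN) (N.inv_mem (hfN _))
    have hBcard : B.card ≤ n₃ := h3 B fun h hh => (Finset.mem_filter.mp hh).2
    calc Tbad.card ≤ ((P ×ˢ B) ×ˢ P).card := Finset.card_le_card hsub
      _ = P.card * B.card * P.card := by simp [Finset.card_product]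
      _ ≤ P.card * n₃ * P.card := by gcongr
  -- the good triples: fibres of `μ` over `w ∉ N` have at most `n₁ n₂` elements
  have hgood : Tgood.card ≤ n₁ * n₂ * W.card := by
    have hmaps : ∀ t ∈ Tgood, μ t ∈ W := by
      intro t ht
      simp only [hTgood, hT, Finset.mem_filter, Finset.mem_product] at ht
      obtain ⟨⟨⟨h11, h12⟩, h2⟩, -⟩ := ht
      simp only [hμ, hW]
      exact Finset.mul_mem_mul (Finset.mul_mem_mul (Finset.mul_mem_mul (Finset.mul_mem_mul
        (Finset.mem_image_of_mem f h11) (Finset.mem_singleton_self b))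
        (Finset.mem_image_of_mem f h12)) (Finset.mem_singleton_self b')) (Finset.mem_image_of_mem f h2)
    have hfib : ∀ w ∈ Tgood.image μ, (Tgood.filter fun t => μ t = w).card ≤ n₁ * n₂ := by
      intro w hw
      obtain ⟨t₀, ht₀, rfl⟩ := Finset.mem_image.mp hw
      have hwN : μ t₀ ∉ N := (Finset.mem_filter.mp ht₀).2
      set Fw := Tgood.filter fun t => μ t = μ t₀ with hFw
      -- project to `p₂`; the image lies in the (F2)-set of `w`
      have himg : (Fw.image fun t => t.1.2).card ≤ n₂ := by
        refine h2 (μ t₀) hwN _ ?_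
        intro h hh
        obtain ⟨t, ht, rfl⟩ := Finset.mem_image.mp hh
        have e : μ t = μ t₀ := (Finset.mem_filter.mp ht).2
        refine ⟨(f t.1.1)⁻¹, ⟨t.1.1⁻¹, map_inv f _⟩, (f t.2)⁻¹, ⟨t.2⁻¹, map_inv f _⟩, ?_⟩
        rw [← e]; simp only [hμ]; group
      -- each `p₂`-fibre has at most `n₁` elements
      have hfib₂ : ∀ p ∈ Fw.image (fun t => t.1.2),
          (Fw.filter fun t => t.1.2 = p).card ≤ n₁ := by
        intro p hp
        obtain ⟨t₁, ht₁, rfl⟩ := Finset.mem_image.mp hp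
        have e₁ : μ t₁ = μ t₀ := (Finset.mem_filter.mp ht₁).2
        set Fp := Fw.filter fun t => t.1.2 = t₁.1.2 with hFp
        -- `t ↦ t.1.1 * t₁.1.1⁻¹` is injective on `Fp` and lands in the (F1)-set of `w`
        have hinj : Set.InjOn (fun t : (H × H) × H => t.1.1 * t₁.1.1⁻¹) ↑Fp := by
          intro t ht t' ht' htt
          simp only [Finset.coe_filter, hFp, Set.mem_setOf_eq, Finset.mem_filter, hFw] at ht ht'
          have e11 : t.1.1 = t'.1.1 := mul_right_cancel htt
          have e12 : t.1.2 = t'.1.2 := by rw [ht.2, ht'.2]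
          have e2 : f t.2 = f t'.2 := by
            have a := ht.1.2
            have a' := ht'.1.2
            simp only [hμ] at a a'
            rw [e11, e12] at a
            exact mul_left_cancel (a.trans a'.symm)
          exact Prod.ext (Prod.ext e11 e12) (hf e2)
        have hland : ∀ t ∈ Fp, (μ t₀)⁻¹ * f (t.1.1 * t₁.1.1⁻¹) * μ t₀ ∈ f.range := by
          intro t ht
          simp only [hFp, hFw, Finset.mem_filter] at ht
          obtain ⟨⟨-, e⟩, e12⟩ := ht
          -- `w⁻¹ f(p₁) f(p₁⁰)⁻¹ w = f(p₃⁻¹ p₃⁰)` where `w = μ t = μ t₁`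
          refine ⟨t.2⁻¹ * t₁.2, ?_⟩
          rw [map_mul, map_inv, map_mul, map_inv]
          have et : μ t₀ = f t.1.1 * b * f t.1.2 * b' * f t.2 := by rw [← e]
          have et₁ : μ t₀ = f t₁.1.1 * b * f t₁.1.2 * b' * f t₁.2 := by rw [← e₁]
          rw [e12] at et
          calc (f t.2)⁻¹ * f t₁.2
              = (f t.1.1 * b * f t₁.1.2 * b' * f t.2)⁻¹ * (f t.1.1 * (f t₁.1.1)⁻¹) *
                  (f t₁.1.1 * b * f t₁.1.2 * b' * f t₁.2) := by group
            _ = (μ t₀)⁻¹ * (f t.1.1 * (f t₁.1.1)⁻¹) * μ t₀ := by rw [← et, ← et₁]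
        calc Fp.card = (Fp.image fun t : (H × H) × H => t.1.1 * t₁.1.1⁻¹).card :=
              (Finset.card_image_of_injOn hinj).symm
          _ ≤ n₁ := by
              refine h1 (μ t₀) hwN _ ?_
              intro h hh
              obtain ⟨t, ht, rfl⟩ := Finset.mem_image.mp hh
              exact hland t ht
      calc Fw.card ≤ n₁ * (Fw.image fun t => t.1.2).card :=
            Finset.card_le_mul_card_image _ n₁ hfib₂
        _ ≤ n₁ * n₂ := by gcongr
    calc Tgood.card ≤ (n₁ * n₂) * (Tgood.image μ).card := Finset.card_le_mul_card_image _ _ hfib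
      _ ≤ (n₁ * n₂) * W.card := by
          gcongr
          exact Finset.image_subset_iff.mpr hmaps
      _ = n₁ * n₂ * W.card := by ring
  calc P.card * P.card * P.card = T.card := hTcard.symm
    _ = Tbad.card + Tgood.card := hsplit.symm
    _ ≤ P.card * n₃ * P.card + n₁ * n₂ * W.card := Nat.add_le_add hbad hgood

/-- `Matrix.SpecialLinearGroup.map ι` is injective for a ring hom `ι` of fields. [folklore] -/
theorem specialLinearGroup_map_injective {k K : Type} [Field k] [Field K] (ι : k →+* K) :
    Function.Injective (Matrix.SpecialLinearGroup.map (n := Fin 2) ι) := by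
  intro a b hab
  ext i j
  have := congrArg (fun g : SL(2, K) => (g : Matrix (Fin 2) (Fin 2) K) i j) hab
  exact ι.injective (by simpa [Matrix.SpecialLinearGroup.map] using this)

/-- **(F1) + (F2) + (F2N) ⟹ (KL-P)** with `C₁ = C₂ = 16`, `q₀ = 1`, in exactly the shapes of
`BGTFreePlan.F1/F2/F2N/TripleProductBound` (the (KL-P) hypothesis of
`structureSliced_of_tripleProduct`).  NOT summit progress. [folklore] -/
theorem tripleProductBound_of_counting
    (h₁ : ∀ (k K : Type) [Field k] [Fintype k] [DecidableEq k] [Field K] [Fintype K] [DecidableEq K]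
      (ι : k →+* K), Fintype.card K = Fintype.card k ^ 2 →
      ∀ g : Matrix.SpecialLinearGroup (Fin 2) K,
        g ∉ Subgroup.normalizer (((Matrix.SpecialLinearGroup.map ι :
            Matrix.SpecialLinearGroup (Fin 2) k →* Matrix.SpecialLinearGroup (Fin 2) K).range :
            Subgroup (Matrix.SpecialLinearGroup (Fin 2) K)) :
            Set (Matrix.SpecialLinearGroup (Fin 2) K)) →
        Nat.card {h : Matrix.SpecialLinearGroup (Fin 2) k //
          g⁻¹ * Matrix.SpecialLinearGroup.map ι h * g ∈ (Matrix.SpecialLinearGroup.map ι :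
            Matrix.SpecialLinearGroup (Fin 2) k →* Matrix.SpecialLinearGroup (Fin 2) K).range} ≤
          2 * Fintype.card k)
    (h₂ : ∀ (k K : Type) [Field k] [Fintype k] [DecidableEq k] [Field K] [Fintype K] [DecidableEq K]
      (ι : k →+* K), Fintype.card K = Fintype.card k ^ 2 →
      ∀ b b' g : Matrix.SpecialLinearGroup (Fin 2) K,
        b ∉ Subgroup.normalizer (((Matrix.SpecialLinearGroup.map ι :
            Matrix.SpecialLinearGroup (Fin 2) k →* Matrix.SpecialLinearGroup (Fin 2) K).range :
            Subgroup (Matrix.SpecialLinearGroup (Fin 2) K)) :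
            Set (Matrix.SpecialLinearGroup (Fin 2) K)) →
        b' ∉ Subgroup.normalizer (((Matrix.SpecialLinearGroup.map ι :
            Matrix.SpecialLinearGroup (Fin 2) k →* Matrix.SpecialLinearGroup (Fin 2) K).range :
            Subgroup (Matrix.SpecialLinearGroup (Fin 2) K)) :
            Set (Matrix.SpecialLinearGroup (Fin 2) K)) →
        g ∉ Subgroup.normalizer (((Matrix.SpecialLinearGroup.map ι :
            Matrix.SpecialLinearGroup (Fin 2) k →* Matrix.SpecialLinearGroup (Fin 2) K).range :
            Subgroup (Matrix.SpecialLinearGroup (Fin 2) K)) :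
            Set (Matrix.SpecialLinearGroup (Fin 2) K)) →
        Nat.card {h : Matrix.SpecialLinearGroup (Fin 2) k //
          ∃ s ∈ (Matrix.SpecialLinearGroup.map ι :
              Matrix.SpecialLinearGroup (Fin 2) k →* Matrix.SpecialLinearGroup (Fin 2) K).range,
          ∃ s' ∈ (Matrix.SpecialLinearGroup.map ι :
              Matrix.SpecialLinearGroup (Fin 2) k →* Matrix.SpecialLinearGroup (Fin 2) K).range,
            b * Matrix.SpecialLinearGroup.map ι h * b' = s * g * s'} ≤
          4 * Fintype.card k * (Fintype.card k + 1))
    (h₃ : ∀ (k K : Type) [Field k] [Fintype k] [DecidableEq k] [Field K] [Fintype K] [DecidableEq K]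
      (ι : k →+* K), Fintype.card K = Fintype.card k ^ 2 →
      ∀ b b' : Matrix.SpecialLinearGroup (Fin 2) K,
        b ∉ Subgroup.normalizer (((Matrix.SpecialLinearGroup.map ι :
            Matrix.SpecialLinearGroup (Fin 2) k →* Matrix.SpecialLinearGroup (Fin 2) K).range :
            Subgroup (Matrix.SpecialLinearGroup (Fin 2) K)) :
            Set (Matrix.SpecialLinearGroup (Fin 2) K)) →
        b' ∉ Subgroup.normalizer (((Matrix.SpecialLinearGroup.map ι :
            Matrix.SpecialLinearGroup (Fin 2) k →* Matrix.SpecialLinearGroup (Fin 2) K).range :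
            Subgroup (Matrix.SpecialLinearGroup (Fin 2) K)) :
            Set (Matrix.SpecialLinearGroup (Fin 2) K)) →
        Nat.card {h : Matrix.SpecialLinearGroup (Fin 2) k //
          b * Matrix.SpecialLinearGroup.map ι h * b' ∈
            Subgroup.normalizer (((Matrix.SpecialLinearGroup.map ι :
              Matrix.SpecialLinearGroup (Fin 2) k →* Matrix.SpecialLinearGroup (Fin 2) K).range :
              Subgroup (Matrix.SpecialLinearGroup (Fin 2) K)) :
              Set (Matrix.SpecialLinearGroup (Fin 2) K))} ≤
          8 * Fintype.card k * (Fintype.card k + 1)) :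
    ∃ C₁ C₂ : ℝ, 0 < C₂ ∧ ∃ q₀ : ℕ,
      ∀ (k K : Type) [Field k] [Fintype k] [DecidableEq k] [Field K] [Fintype K] [DecidableEq K]
        (ι : k →+* K), Fintype.card K = Fintype.card k ^ 2 → q₀ ≤ Fintype.card k →
        ∀ (P : Finset (Matrix.SpecialLinearGroup (Fin 2) k))
          (b b' : Matrix.SpecialLinearGroup (Fin 2) K),
          b ∉ Subgroup.normalizer (((Matrix.SpecialLinearGroup.map ι :
              Matrix.SpecialLinearGroup (Fin 2) k →* Matrix.SpecialLinearGroup (Fin 2) K).range :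
              Subgroup (Matrix.SpecialLinearGroup (Fin 2) K)) :
              Set (Matrix.SpecialLinearGroup (Fin 2) K)) →
          b' ∉ Subgroup.normalizer (((Matrix.SpecialLinearGroup.map ι :
              Matrix.SpecialLinearGroup (Fin 2) k →* Matrix.SpecialLinearGroup (Fin 2) K).range :
              Subgroup (Matrix.SpecialLinearGroup (Fin 2) K)) :
              Set (Matrix.SpecialLinearGroup (Fin 2) K)) →
          (P.card : ℝ) * ((P.card : ℝ) - C₁ * (Fintype.card k : ℝ) ^ 2) * P.card ≤
            C₂ * (Fintype.card k : ℝ) ^ 3 *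
              ((P.image (Matrix.SpecialLinearGroup.map ι) * {b} *
                P.image (Matrix.SpecialLinearGroup.map ι) * {b'} *
                P.image (Matrix.SpecialLinearGroup.map ι)).card : ℝ) := by
  refine ⟨16, 16, by norm_num, 1, ?_⟩
  intro k K _ _ _ _ _ _ ι hK _hq P b b' hb hb'
  set q := Fintype.card k with hq
  set f : SL(2, k) →* SL(2, K) := Matrix.SpecialLinearGroup.map ι with hf
  set N := Subgroup.normalizer ((f.range : Subgroup SL(2, K)) : Set SL(2, K)) with hN
  have hSN : f.range ≤ N := Subgroup.le_normalizer
  have hcount := tripleProduct_fibre_count f (specialLinearGroup_map_injective ι) N hSN b b' P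
    (2 * q) (4 * q * (q + 1)) (8 * q * (q + 1))
    (fun w hw S hS => (card_le_natCard_subtype _ S hS).trans (h₁ k K ι hK w hw))
    (fun w hw S hS => (card_le_natCard_subtype _ S hS).trans (h₂ k K ι hK b b' w hb hb' hw))
    (fun S hS => (card_le_natCard_subtype _ S hS).trans (h₃ k K ι hK b b' hb hb'))
  -- real arithmetic
  set p : ℕ := P.card with hp
  set t : ℕ := (P.image f * {b} * P.image f * {b'} * P.image f).card with ht
  have hq1 : 1 ≤ q := _hq
  have hR : (p : ℝ) * p * p ≤ p * (8 * q * (q + 1)) * p + (2 * q) * (4 * q * (q + 1)) * t := by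
    exact_mod_cast hcount
  have hq' : (1 : ℝ) ≤ q := by exact_mod_cast hq1
  have hp0 : (0 : ℝ) ≤ p := Nat.cast_nonneg _
  have ht0 : (0 : ℝ) ≤ t := Nat.cast_nonneg _
  have e1 : (8 : ℝ) * q * (q + 1) ≤ 16 * q ^ 2 := by nlinarith
  have e2 : (2 : ℝ) * q * (4 * q * (q + 1)) ≤ 16 * q ^ 3 := by nlinarith
  calc (p : ℝ) * ((p : ℝ) - 16 * (q : ℝ) ^ 2) * p
      ≤ (p : ℝ) * ((p : ℝ) - 8 * q * (q + 1)) * p := by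
        have : (p : ℝ) * ((p : ℝ) - 16 * (q : ℝ) ^ 2) ≤ (p : ℝ) * ((p : ℝ) - 8 * q * (q + 1)) :=
          mul_le_mul_of_nonneg_left (by linarith) hp0
        exact mul_le_mul_of_nonneg_right this hp0
    _ = (p : ℝ) * p * p - p * (8 * q * (q + 1)) * p := by ring
    _ ≤ (2 * q) * (4 * q * (q + 1)) * t := by linarith
    _ ≤ 16 * (q : ℝ) ^ 3 * t := mul_le_mul_of_nonneg_right e2 ht0

end Summit.MatrixMultiplication.MatrixMultiplication.Theorems.GradedDesignFamily.Negative
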